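import Mathlib
import Summits.ValiantsHypothesis.ValiantsHypothesis.Theorems.KPlusLogSqLawLiftingLocalDescartesChain
import Summits.ValiantsHypothesis.ValiantsHypothesis.Theorems.KPlusLogSqLawLiftingFiniteBaseDominance

/-!
# Patchworking at FINITE base, part 2: window-by-window real root counts of a patchworked pencil; exactness at base `N^{1/M}`

HONEST FRAMING.  Helper file toward the lifting crux `WeakLifting` (stmt-ValiantsHypothesis-19561; aside `Lifting`
stmt-ValiantsHypothesis-19772, registered stub `stub_liftThin`) of route `KPlusLogSqLaw` (cell `pub-symmetroid`, seat
val-sym-lift-p1 g9, 2026-08-27).  DESIGN-LEVEL corollaries of the local Descartes rule for the patchworked pencil of ONE tropical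
design — statements about NEAR-TROPICAL pencils (GAP-LIFT §4 (S-near) of val-sym-lift-p4 made a theorem).  Nothing here asserts
`WeakLifting`, `TropicalB`, Conjecture B, `MatrixDescartes` (stmt-ValiantsHypothesis-18050) or anything about VP ≠ VNP, and nothing
is claimed about general (far-from-tropical) pencils, whose windows merge.

SETTING as in part 1 (`…LiftingFiniteBaseDominance`): design `(d, v, ε)`, base `b > 1`, `f_b = det Σ_l X^{d_l} · patchMatrix b v ε l`
with merged coefficients `c_s(b)`, `N = m!·K^m` Leibniz terms, «`p` dominant with margin `M` at the integer slope `θ`»; throughout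
`N ≤ b^M` (base `b ≥ N^{1/M}`).

RESULTS.
* `card_roots_window_le_signVar_of_margin` — WINDOW LAW: if `p₁` is margin-`M` dominant at `θ₁` and `p₂` at `θ₂ > θ₁`, the distinct
  zeros of `f_b` in `(b^{θ₁}, b^{θ₂})` number at most `Var(c_s(b) : D(p₁) ≤ s ≤ D(p₂))` (local Descartes rule between the two
  monomial-dominance points of part 1); counting form `card_roots_window_le_card_slopes_sub_one`: at most
  `#{present slopes in [D(p₁), D(p₂)]} − 1` — a window's excess over its tropical count is carried by HIDDEN (present, never
  dominant) interior slopes only.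
* `card_roots_window_eq_of_noHidden` — EXACT WINDOW: with no present slope strictly between `D(p₁)` and `D(p₂)` the count is `1` if
  `termSign p₁ · termSign p₂ < 0` and `0` otherwise.
* `card_posRoots_le_sum_signVar_of_margin` — along a margin-`M` dominant chain `θ_0 < ⋯ < θ_r` the positive zeros of `f_b` number at
  most `Var(c_0..c_{D P_0}) + Σ_k Var(c_{D P_k}..c_{D P_{k+1}}) + Var(c_{D P_r}..c_n)` (as a TOTAL this equals Descartes' `Var` of the whole
  coefficient sequence — the law LOCALISES the count window by window, it does not lower it).
* `card_posRoots_eq_card_alternating_of_margin` — PATCHWORKING IS EXACT AT BASE `b ≥ N^{1/M}`: if the chain's slopes span the present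
  slopes and none is hidden between consecutive ones, the number of distinct positive zeros of `f_b` EQUALS the alternation count
  `#{k : termSign P_k · termSign P_{k+1} < 0}`.  (Lift-p2's `ExactPatchwork.card_posRoots_patch_eq_card_alternating` needs
  `b ≥ 16 N (D+1) 4^D` with margin `1` at integer TIE slopes and allows hidden slopes; here the base carries the margin instead of
  the degree, the chain is read at dominance slopes, and hidden slopes are paid for by the local `Var`.)
No `def`.  [folklore] (one-variable Viro patchworking made quantitative; lower-bound direction = the tree's `le_card_posRoots_patch`
/ Viro polynomial systems of Bihan–Santos–Spaenlehauer; the window direction is the local Descartes rule.)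
-/

set_option linter.dupNamespace false
set_option autoImplicit false

namespace Summit.ValiantsHypothesis.ValiantsHypothesis.Theorems.KPlusLogSqLaw.LocalDescartes

open Polynomial Finset
open scoped BigOperators
open Literature.Algebra.Polynomial (signVar signVarAux)
open Summit.ValiantsHypothesis.ValiantsHypothesis.Theorems.MatrixDescartes.Negative
  (patchMatrix tropWeight termSign)
open Summit.ValiantsHypothesis.ValiantsHypothesis.Theorems.KPlusLogSqLaw.ExactPatchwork
  (exists_present_of_mem_support exists_root_of_alternating_window)

variable {m K : ℕ}

/-! ## The window law at finite base -/

/-- **WINDOW LAW AT FINITE BASE.**  Let `p₁` be dominant with margin `M` at the integer slope `θ₁` and `p₂` at `θ₂ > θ₁`, and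
`N ≤ b^M`.  Then the number of distinct zeros of `f_b = det F_b` in the window `(b^{θ₁}, b^{θ₂})` is at most the number of sign changes
of the MERGED coefficients `c_s(b)`, `D(p₁) ≤ s ≤ D(p₂)` (local Descartes rule between the two monomial-dominance points). [folklore] -/
theorem card_roots_window_le_signVar_of_margin (b : ℝ) (hb : 1 < b) (d : Fin K → ℕ) (v ε : Fin m → Fin m → Fin K → ℤ)
    (hε : ∀ i j l, (ε i j l).natAbs ≤ 1) (M : ℕ)
    (hN : (Fintype.card (Equiv.Perm (Fin m) × (Fin m → Fin K)) : ℝ) ≤ b ^ M)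
    {θ₁ θ₂ : ℤ} (hθ : θ₁ < θ₂) (p₁ p₂ : Equiv.Perm (Fin m) × (Fin m → Fin K))
    (hp₁ : termSign ε p₁ ≠ 0) (hp₂ : termSign ε p₂ ≠ 0)
    (hmar₁ : ∀ q, q ≠ p₁ → termSign ε q ≠ 0 → tropWeight d v θ₁ q + M ≤ tropWeight d v θ₁ p₁)
    (hmar₂ : ∀ q, q ≠ p₂ → termSign ε q ≠ 0 → tropWeight d v θ₂ q + M ≤ tropWeight d v θ₂ p₂) :
    (((∑ l, (X : ℝ[X]) ^ d l • (patchMatrix b v ε l).map C).det).roots.toFinset.filter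
        (fun x => b ^ θ₁ < x ∧ x < b ^ θ₂)).card
      ≤ signVar ((List.range ((∑ i, d (p₂.2 i)) + 1 - ∑ i, d (p₁.2 i))).map
          (fun k => ((∑ l, (X : ℝ[X]) ^ d l • (patchMatrix b v ε l).map C).det).coeff ((∑ i, d (p₁.2 i)) + k))) := by
  have hb0 : 0 < b := lt_trans one_pos hb
  exact card_roots_Ioo_le_signVar_coeffs _ (zpow_pos hb0 θ₁) (zpow_lt_zpow_right₀ hb hθ)
    (slope_le_of_margin d v ε hθ M p₁ p₂ hp₁ hp₂ hmar₁ hmar₂)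
    (monomial_dominant_of_margin b hb d v ε hε θ₁ M p₁ hp₁ hmar₁ hN)
    (monomial_dominant_of_margin b hb d v ε hε θ₂ M p₂ hp₂ hmar₂ hN)

/-- the non-zero entries of a mapped range are counted by the corresponding filtered `Finset.range`. [folklore] -/
theorem length_filter_map_range_eq_card (g : ℕ → ℝ) (n : ℕ) :
    (((List.range n).map g).filter (fun a => a ≠ 0)).length = ((Finset.range n).filter (fun k => g k ≠ 0)).card := by
  classical
  rw [List.filter_map, List.length_map]
  have hnd : ((List.range n).filter ((fun a : ℝ => decide (a ≠ 0)) ∘ g)).Nodup := (List.nodup_range).filter _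
  rw [← List.toFinset_card_of_nodup hnd, List.toFinset_filter, List.toFinset_range]
  congr 1
  ext k
  simp [Function.comp]

/-- `Var` of a mapped range is at most the number of indices with non-zero value, minus one. [folklore] -/
theorem signVar_map_range_le_card_sub_one (g : ℕ → ℝ) (n : ℕ) :
    signVar ((List.range n).map g) ≤ ((Finset.range n).filter (fun k => g k ≠ 0)).card - 1 := by
  classical
  unfold signVar
  refine (Literature.Computability.AlgebraicComplexity.signVarAux_le_length_sub_one _).trans ?_
  exact Nat.sub_le_sub_right (le_of_eq (length_filter_map_range_eq_card g n)) 1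

/-- **WINDOW LAW, counting form**: the zeros of `f_b` in `(b^{θ₁}, b^{θ₂})` number at most `#{present slopes in [D(p₁), D(p₂)]} − 1`;
in particular the window's excess over its tropical count `[termSign p₁ ≠ termSign p₂]` is carried by HIDDEN (present, never dominant)
interior slopes only. [folklore] -/
theorem card_roots_window_le_card_slopes_sub_one (b : ℝ) (hb : 1 < b) (d : Fin K → ℕ) (v ε : Fin m → Fin m → Fin K → ℤ)
    (hε : ∀ i j l, (ε i j l).natAbs ≤ 1) (M : ℕ)
    (hN : (Fintype.card (Equiv.Perm (Fin m) × (Fin m → Fin K)) : ℝ) ≤ b ^ M)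
    {θ₁ θ₂ : ℤ} (hθ : θ₁ < θ₂) (p₁ p₂ : Equiv.Perm (Fin m) × (Fin m → Fin K))
    (hp₁ : termSign ε p₁ ≠ 0) (hp₂ : termSign ε p₂ ≠ 0)
    (hmar₁ : ∀ q, q ≠ p₁ → termSign ε q ≠ 0 → tropWeight d v θ₁ q + M ≤ tropWeight d v θ₁ p₁)
    (hmar₂ : ∀ q, q ≠ p₂ → termSign ε q ≠ 0 → tropWeight d v θ₂ q + M ≤ tropWeight d v θ₂ p₂) :
    (((∑ l, (X : ℝ[X]) ^ d l • (patchMatrix b v ε l).map C).det).roots.toFinset.filter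
        (fun x => b ^ θ₁ < x ∧ x < b ^ θ₂)).card
      ≤ ((Finset.Icc (∑ i, d (p₁.2 i)) (∑ i, d (p₂.2 i))).filter
          (fun s => ∃ q : Equiv.Perm (Fin m) × (Fin m → Fin K), termSign ε q ≠ 0 ∧ (∑ i, d (q.2 i)) = s)).card - 1 := by
  classical
  have hb0 : 0 < b := lt_trans one_pos hb
  set f := ((∑ l, (X : ℝ[X]) ^ d l • (patchMatrix b v ε l).map C).det) with hf
  set D₁ := ∑ i, d (p₁.2 i) with hD₁
  set D₂ := ∑ i, d (p₂.2 i) with hD₂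
  refine (card_roots_window_le_signVar_of_margin b hb d v ε hε M hN hθ p₁ p₂ hp₁ hp₂ hmar₁ hmar₂).trans ?_
  rw [← hf, ← hD₁, ← hD₂]
  refine (signVar_map_range_le_card_sub_one (fun k => f.coeff (D₁ + k)) (D₂ + 1 - D₁)).trans ?_
  refine Nat.sub_le_sub_right (Finset.card_le_card_of_injOn (fun k => D₁ + k) (fun k hk => ?_) ?_) 1
  · rw [Finset.mem_coe, Finset.mem_filter, Finset.mem_range] at hk
    rw [Finset.mem_coe, Finset.mem_filter, Finset.mem_Icc]
    obtain ⟨hk1, hk2⟩ := hk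
    refine ⟨⟨?_, ?_⟩, ?_⟩
    · show D₁ ≤ D₁ + k
      omega
    · show D₁ + k ≤ D₂
      omega
    · exact exists_present_of_mem_support b hb0 d v ε (Polynomial.mem_support_iff.mpr hk2)
  · intro k₁ _ k₂ _ h
    simpa using h

/-- **EXACT WINDOW AT FINITE BASE.**  If moreover NO present term has slope strictly between `D(p₁)` and `D(p₂)`, the number of
distinct zeros of `f_b` in `(b^{θ₁}, b^{θ₂})` is EXACTLY `1` if `termSign p₁ · termSign p₂ < 0` and `0` otherwise (upper bound:
the window law, the window's `Var` being the alternation indicator since the merged end coefficients carry the signs of their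
terms; lower bound: the intermediate value theorem). [folklore] -/
theorem card_roots_window_eq_of_noHidden (b : ℝ) (hb : 1 < b) (d : Fin K → ℕ) (v ε : Fin m → Fin m → Fin K → ℤ)
    (hε : ∀ i j l, (ε i j l).natAbs ≤ 1) (M : ℕ)
    (hN : (Fintype.card (Equiv.Perm (Fin m) × (Fin m → Fin K)) : ℝ) ≤ b ^ M)
    {θ₁ θ₂ : ℤ} (hθ : θ₁ < θ₂) (p₁ p₂ : Equiv.Perm (Fin m) × (Fin m → Fin K))
    (hp₁ : termSign ε p₁ ≠ 0) (hp₂ : termSign ε p₂ ≠ 0)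
    (hmar₁ : ∀ q, q ≠ p₁ → termSign ε q ≠ 0 → tropWeight d v θ₁ q + M ≤ tropWeight d v θ₁ p₁)
    (hmar₂ : ∀ q, q ≠ p₂ → termSign ε q ≠ 0 → tropWeight d v θ₂ q + M ≤ tropWeight d v θ₂ p₂)
    (hno : ∀ q : Equiv.Perm (Fin m) × (Fin m → Fin K), termSign ε q ≠ 0 →
      ¬ ((∑ i, d (p₁.2 i)) < (∑ i, d (q.2 i)) ∧ (∑ i, d (q.2 i)) < ∑ i, d (p₂.2 i))) :
    (((∑ l, (X : ℝ[X]) ^ d l • (patchMatrix b v ε l).map C).det).roots.toFinset.filter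
        (fun x => b ^ θ₁ < x ∧ x < b ^ θ₂)).card
      = if termSign ε p₁ * termSign ε p₂ < 0 then 1 else 0 := by
  classical
  have hb0 : 0 < b := lt_trans one_pos hb
  set f := ((∑ l, (X : ℝ[X]) ^ d l • (patchMatrix b v ε l).map C).det) with hf
  set D₁ := ∑ i, d (p₁.2 i) with hD₁
  set D₂ := ∑ i, d (p₂.2 i) with hD₂
  have hD : D₁ ≤ D₂ := slope_le_of_margin d v ε hθ M p₁ p₂ hp₁ hp₂ hmar₁ hmar₂
  have hs₁ := termSign_mul_coeff_pos_of_margin b hb d v ε hε θ₁ M p₁ hp₁ hmar₁ hN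
  have hs₂ := termSign_mul_coeff_pos_of_margin b hb d v ε hε θ₂ M p₂ hp₂ hmar₂ hN
  rw [← hf, ← hD₁] at hs₁
  rw [← hf, ← hD₂] at hs₂
  have hdom₁ := monomial_dominant_of_margin b hb d v ε hε θ₁ M p₁ hp₁ hmar₁ hN
  have hdom₂ := monomial_dominant_of_margin b hb d v ε hε θ₂ M p₂ hp₂ hmar₂ hN
  rw [← hf, ← hD₁] at hdom₁
  rw [← hf, ← hD₂] at hdom₂
  have hf0 : f ≠ 0 := by
    intro h; rw [h, Polynomial.coeff_zero, mul_zero] at hs₁; exact lt_irrefl _ hs₁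
  -- the coefficient signs are the term signs
  have hiff : f.coeff D₁ * f.coeff D₂ < 0 ↔ termSign ε p₁ * termSign ε p₂ < 0 := by
    have key : 0 < ((termSign ε p₁ : ℝ) * (termSign ε p₂ : ℝ)) * (f.coeff D₁ * f.coeff D₂) := by
      have := mul_pos hs₁ hs₂; linarith [this]
    constructor
    · intro h
      have : (termSign ε p₁ : ℝ) * (termSign ε p₂ : ℝ) < 0 := by
        by_contra hge; push Not at hge
        have := mul_nonpos_of_nonneg_of_nonpos hge h.le
        linarith
      exact_mod_cast this
    · intro h
      have h' : (termSign ε p₁ : ℝ) * (termSign ε p₂ : ℝ) < 0 := by exact_mod_cast h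
      by_contra hge; push Not at hge
      have := mul_nonpos_of_nonpos_of_nonneg h'.le hge
      linarith
  -- upper bound: the window's `Var`
  have hup : (f.roots.toFinset.filter (fun x => b ^ θ₁ < x ∧ x < b ^ θ₂)).card
      ≤ if termSign ε p₁ * termSign ε p₂ < 0 then 1 else 0 := by
    have h := card_roots_window_le_signVar_of_margin b hb d v ε hε M hN hθ p₁ p₂ hp₁ hp₂ hmar₁ hmar₂
    rw [← hf, ← hD₁, ← hD₂] at h
    rw [signVar_window_of_noInterior f hD (fun s hs hlt => ?_)] at h
    · by_cases halt : termSign ε p₁ * termSign ε p₂ < 0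
      · rw [if_pos halt]; rw [if_pos (hiff.mpr halt)] at h; exact h
      · rw [if_neg halt]; rw [if_neg (fun h' => halt (hiff.mp h'))] at h; exact h
    · obtain ⟨q, hq, hqs⟩ := exists_present_of_mem_support b hb0 d v ε hs
      exact hno q hq ⟨by rw [hqs]; exact hlt.1, by rw [hqs]; exact hlt.2⟩
  refine le_antisymm hup ?_
  by_cases halt : termSign ε p₁ * termSign ε p₂ < 0
  · rw [if_pos halt]
    obtain ⟨y, hy, hy0⟩ := exists_root_of_alternating_window f (zpow_pos hb0 θ₁) (zpow_lt_zpow_right₀ hb hθ).le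
      hdom₁ hdom₂ (hiff.mpr halt)
    refine Finset.one_le_card.mpr ⟨y, Finset.mem_filter.mpr ⟨?_, hy.1, hy.2⟩⟩
    rw [Multiset.mem_toFinset, Polynomial.mem_roots hf0]
    exact hy0
  · rw [if_neg halt]; exact Nat.zero_le _

/-! ## Along a margin-dominant chain: patchworking is exact at base `b ≥ N^{1/M}` -/

/-- **SUM LAW ALONG A CHAIN AT FINITE BASE.**  Along a chain `θ_0 < ⋯ < θ_r` of integer slopes at which the terms `P_0, …, P_r` are
dominant with margin `M` (`N ≤ b^M`), the distinct positive zeros of `f_b` number at most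
`Var(c_0..c_{D P_0}) + Σ_k Var(c_{D P_k}..c_{D P_{k+1}}) + Var(c_{D P_r}..c_n)`. [folklore] -/
theorem card_posRoots_le_sum_signVar_of_margin (b : ℝ) (hb : 1 < b) (d : Fin K → ℕ) (v ε : Fin m → Fin m → Fin K → ℤ)
    (hε : ∀ i j l, (ε i j l).natAbs ≤ 1) (M : ℕ)
    (hN : (Fintype.card (Equiv.Perm (Fin m) × (Fin m → Fin K)) : ℝ) ≤ b ^ M)
    (r : ℕ) (θ : Fin (r + 1) → ℤ) (hθ : StrictMono θ) (P : Fin (r + 1) → Equiv.Perm (Fin m) × (Fin m → Fin K))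
    (hP : ∀ k, termSign ε (P k) ≠ 0)
    (hmar : ∀ k q, q ≠ P k → termSign ε q ≠ 0 → tropWeight d v (θ k) q + M ≤ tropWeight d v (θ k) (P k)) :
    (((∑ l, (X : ℝ[X]) ^ d l • (patchMatrix b v ε l).map C).det).roots.toFinset.filter (fun t => 0 < t)).card
      ≤ signVar ((List.range ((∑ i, d ((P 0).2 i)) + 1)).map
            ((∑ l, (X : ℝ[X]) ^ d l • (patchMatrix b v ε l).map C).det).coeff)
        + ∑ k : Fin r, signVar ((List.range ((∑ i, d ((P k.succ).2 i)) + 1 - ∑ i, d ((P k.castSucc).2 i))).map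
            (fun j => ((∑ l, (X : ℝ[X]) ^ d l • (patchMatrix b v ε l).map C).det).coeff ((∑ i, d ((P k.castSucc).2 i)) + j)))
        + signVar ((List.range (((∑ l, (X : ℝ[X]) ^ d l • (patchMatrix b v ε l).map C).det).natDegree + 1
              - ∑ i, d ((P (Fin.last r)).2 i))).map
            (fun j => ((∑ l, (X : ℝ[X]) ^ d l • (patchMatrix b v ε l).map C).det).coeff ((∑ i, d ((P (Fin.last r)).2 i)) + j))) := by
  have hb0 : 0 < b := lt_trans one_pos hb
  exact card_posRoots_le_sum_signVar _ r (fun k => ∑ i, d ((P k).2 i)) (fun k => b ^ θ k)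
    (fun i j hij => zpow_lt_zpow_right₀ hb (hθ hij)) (zpow_pos hb0 _)
    (fun k => monomial_dominant_of_margin b hb d v ε hε (θ k) M (P k) (hP k) (hmar k) hN)

/-- **PATCHWORKING IS EXACT AT FINITE BASE `b ≥ N^{1/M}`.**  Let `θ_0 < ⋯ < θ_r` be integer slopes at which the terms `P_0, …, P_r`
are dominant with margin `M`, `N ≤ b^M`, such that every present slope lies in `[D(P_0), D(P_r)]` and no present slope lies strictly
between two consecutive `D(P_k)` (no hidden slopes).  Then the number of distinct positive zeros of `f_b = det F_b` EQUALS the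
alternation count `#{k : termSign P_k · termSign P_{k+1} < 0}` of the chain — the tree's lower bound `le_card_posRoots_patch` is an
equality already at base `N^{1/M}` (lift-p2's `card_posRoots_patch_eq_card_alternating`: base `16 N (D+1) 4^D`, margin `1`, tie
slopes, hidden slopes allowed). [folklore] -/
theorem card_posRoots_eq_card_alternating_of_margin (b : ℝ) (hb : 1 < b) (d : Fin K → ℕ)
    (v ε : Fin m → Fin m → Fin K → ℤ) (hε : ∀ i j l, (ε i j l).natAbs ≤ 1) (M : ℕ)
    (hN : (Fintype.card (Equiv.Perm (Fin m) × (Fin m → Fin K)) : ℝ) ≤ b ^ M)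
    (r : ℕ) (θ : Fin (r + 1) → ℤ) (hθ : StrictMono θ) (P : Fin (r + 1) → Equiv.Perm (Fin m) × (Fin m → Fin K))
    (hP : ∀ k, termSign ε (P k) ≠ 0)
    (hmar : ∀ k q, q ≠ P k → termSign ε q ≠ 0 → tropWeight d v (θ k) q + M ≤ tropWeight d v (θ k) (P k))
    (hrange : ∀ q : Equiv.Perm (Fin m) × (Fin m → Fin K), termSign ε q ≠ 0 →
      (∑ i, d ((P 0).2 i)) ≤ (∑ i, d (q.2 i)) ∧ (∑ i, d (q.2 i)) ≤ ∑ i, d ((P (Fin.last r)).2 i))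
    (hno : ∀ q : Equiv.Perm (Fin m) × (Fin m → Fin K), termSign ε q ≠ 0 → ∀ k : Fin r,
      ¬ ((∑ i, d ((P k.castSucc).2 i)) < (∑ i, d (q.2 i)) ∧ (∑ i, d (q.2 i)) < ∑ i, d ((P k.succ).2 i))) :
    (((∑ l, (X : ℝ[X]) ^ d l • (patchMatrix b v ε l).map C).det).roots.toFinset.filter (fun t => 0 < t)).card
      = (Finset.univ.filter (fun k : Fin r => termSign ε (P k.castSucc) * termSign ε (P k.succ) < 0)).card := by
  classical
  have hb0 : 0 < b := lt_trans one_pos hb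
  set f := ((∑ l, (X : ℝ[X]) ^ d l • (patchMatrix b v ε l).map C).det) with hf
  have hdom : ∀ k, ∑ s ∈ f.support.erase (∑ i, d ((P k).2 i)), |f.coeff s| * (b ^ θ k) ^ s
      < |f.coeff (∑ i, d ((P k).2 i))| * (b ^ θ k) ^ (∑ i, d ((P k).2 i)) :=
    fun k => monomial_dominant_of_margin b hb d v ε hε (θ k) M (P k) (hP k) (hmar k) hN
  have hsign : ∀ k, 0 < (termSign ε (P k) : ℝ) * f.coeff (∑ i, d ((P k).2 i)) :=
    fun k => termSign_mul_coeff_pos_of_margin b hb d v ε hε (θ k) M (P k) (hP k) (hmar k) hN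
  rw [card_posRoots_eq_card_alternating_of_chain f r (fun k => ∑ i, d ((P k).2 i)) (fun k => b ^ θ k)
    (fun i j hij => zpow_lt_zpow_right₀ hb (hθ hij)) (zpow_pos hb0 _) hdom
    (fun s hs => ?_) (fun s hs => ?_) (fun s hs k => ?_)]
  · refine Finset.card_bij (fun k _ => k) (fun k hk => ?_) (fun _ _ _ _ h => h) (fun k hk => ⟨k, ?_, rfl⟩)
    · rw [Finset.mem_filter] at hk ⊢
      refine ⟨hk.1, ?_⟩
      have key : 0 < ((termSign ε (P k.castSucc) : ℝ) * (termSign ε (P k.succ) : ℝ))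
          * (f.coeff (∑ i, d ((P k.castSucc).2 i)) * f.coeff (∑ i, d ((P k.succ).2 i))) := by
        have := mul_pos (hsign k.castSucc) (hsign k.succ); linarith [this]
      have : (termSign ε (P k.castSucc) : ℝ) * (termSign ε (P k.succ) : ℝ) < 0 := by
        by_contra hge; push Not at hge
        linarith [mul_nonpos_of_nonneg_of_nonpos hge hk.2.le]
      exact_mod_cast this
    · rw [Finset.mem_filter] at hk ⊢
      refine ⟨hk.1, ?_⟩
      have key : 0 < ((termSign ε (P k.castSucc) : ℝ) * (termSign ε (P k.succ) : ℝ))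
          * (f.coeff (∑ i, d ((P k.castSucc).2 i)) * f.coeff (∑ i, d ((P k.succ).2 i))) := by
        have := mul_pos (hsign k.castSucc) (hsign k.succ); linarith [this]
      have h' : (termSign ε (P k.castSucc) : ℝ) * (termSign ε (P k.succ) : ℝ) < 0 := by exact_mod_cast hk.2
      by_contra hge; push Not at hge
      linarith [mul_nonpos_of_nonpos_of_nonneg h'.le hge]
  · obtain ⟨q, hq, hqs⟩ := exists_present_of_mem_support b hb0 d v ε hs
    rw [← hqs]; exact (hrange q hq).1
  · obtain ⟨q, hq, hqs⟩ := exists_present_of_mem_support b hb0 d v ε hs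
    rw [← hqs]; exact (hrange q hq).2
  · obtain ⟨q, hq, hqs⟩ := exists_present_of_mem_support b hb0 d v ε hs
    rw [← hqs]; exact hno q hq k

end Summit.ValiantsHypothesis.ValiantsHypothesis.Theorems.KPlusLogSqLaw.LocalDescartes
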